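import Summits.AtomisticToContinuum.HydrodynamicLimit.Theorems.ImplosionDichotomyPolynomialCompressionEosCesaro

/-!
# Hard-sphere free volume: monotonicity and the `limsup` free energy (helpers for `HsFreeEnergyConvex`)

Helpers for support item stmt-AtomisticToContinuum-9526 (`HsFreeEnergyConvex`): elementary facts on
`hsFreeVolume η N` (Haar measure of the non-overlap set of `N` points of `𝕋³` at minimal-image
distance `≥ (η/N)^{1/3}`, `EosCesaro.hsFreeVolume_eq_toReal`), on the rate
`a_N(η) = -N⁻¹ log hsFreeVolume η N ≥ 0` and on `hsExcessFreeEnergy η = limsup_N a_N(η)`: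

* `hsFreeVolume_anti`: the free volume decreases with the density (larger exclusion distance);
* `hsFreeVolume_scale_le` (**particle removal**): for `1 ≤ N ≤ N'`,
  `hsFreeVolume (η N'/N) N' ≤ hsFreeVolume η N` — forgetting `N' - N` particles at fixed exclusion
  distance `(η/N)^{1/3}` only enlarges the admissible set (marginalisation
  `integral_pi_comp_castLE`);
* `rate_nonneg`, `rate_le_of_exp_le`, `rate_le_rate_of_pos`, `rate_le_scale_rate`: the rate is
  `≥ 0`, is `≤ C` when `hsFreeVolume ≥ e^{-CN}`, increases with `η` wherever the free volume is
  positive, and `a_N(η) ≤ (N'/N) a_{N'}(η N'/N)`;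
* `hsExcessFreeEnergy_nonneg` (unconditionally, also for the junk value of an unbounded `limsup`),
  `hsExcessFreeEnergy_le_of_eventually_le`, `eventually_rate_le_add`, `hsExcessFreeEnergy_mono_of`:
  the `limsup` bookkeeping (`Filter.limsup_le_of_le`, `Filter.eventually_lt_of_limsup_lt`,
  `Filter.limsup_le_limsup`) under an eventual upper bound on the rate — supplied downstream by the
  body-centred-cubic a-priori bound.

Reference: D. Ruelle, *Statistical Mechanics: Rigorous Results* (1969), §3.4.
-/

namespace Summit.AtomisticToContinuum.HydrodynamicLimit.Theorems

open Set MeasureTheory Filter Topology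
open scoped ENNReal
open Literature.MathematicalPhysics.KineticTheory

namespace HsFreeEnergyConvex

/-! ### The free volume -/

/-- The free volume is non-negative. [folklore] -/
theorem hsFreeVolume_nonneg (η : ℝ) (N : ℕ) : 0 ≤ hsFreeVolume η N := by
  rw [EosCesaro.hsFreeVolume_eq_toReal]
  exact ENNReal.toReal_nonneg

/-- The non-overlap sets decrease with the exclusion distance. [folklore] -/
theorem posDomain_anti {ε ε' : ℝ} (h : ε ≤ ε') (n : ℕ) : posDomain ε' n ⊆ posDomain ε n :=
  fun _ hx i j hij => h.trans (hx i j hij)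

/-- **Monotonicity in the density**: for `0 ≤ η ≤ η'` the free volume at density `η'` is at most
the one at density `η` (the exclusion distance `(η/N)^{1/3}` increases). [cite: Ruelle1969, §3.4] -/
theorem hsFreeVolume_anti {η η' : ℝ} (hη : 0 ≤ η) (h : η ≤ η') (N : ℕ) :
    hsFreeVolume η' N ≤ hsFreeVolume η N := by
  rw [EosCesaro.hsFreeVolume_eq_toReal, EosCesaro.hsFreeVolume_eq_toReal]
  refine ENNReal.toReal_mono (measure_ne_top _ _) (measure_mono (posDomain_anti ?_ N))
  exact Real.rpow_le_rpow (div_nonneg hη (Nat.cast_nonneg _))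
    (div_le_div_of_nonneg_right h (Nat.cast_nonneg _)) (by norm_num)

/-- The Haar measure of `𝕋³` is the one-particle law of the uniform profile. [folklore] -/
theorem uniformProfile_μ : uniformProfile.μ = (volume : Measure T3) := by
  simp only [DensityProfile.μ, uniformProfile, ENNReal.ofReal_one]
  rw [withDensity_const, one_smul]

/-- **Particle removal** at fixed exclusion distance: for `N ≤ N'` the Haar measure of the
non-overlap set of `N'` points is at most that of `N` points (forgetting the last `N' - N` points,
marginalisation over the product measure). [cite: Ruelle1969, §3.4] -/
theorem volume_posDomain_le {N N' : ℕ} (h : N ≤ N') (ε : ℝ) :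
    (volume (posDomain ε N')).toReal ≤ (volume (posDomain ε N)).toReal := by
  have hF : Measurable ((posDomain ε N).indicator (1 : (Fin N → T3) → ℝ)) :=
    measurable_one.indicator (measurableSet_posDomain ε N)
  have key := integral_pi_comp_castLE uniformProfile h hF
  rw [uniformProfile_μ] at key
  have hvolN : (volume : Measure (Fin N → T3)) = Measure.pi fun _ => volume := rfl
  have hvolN' : (volume : Measure (Fin N' → T3)) = Measure.pi fun _ => volume := rfl
  have hR : ∫ y : Fin N → T3, (posDomain ε N).indicator (1 : (Fin N → T3) → ℝ) y
      ∂(Measure.pi fun _ => volume) = (volume (posDomain ε N)).toReal := by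
    rw [← hvolN, integral_indicator_one (measurableSet_posDomain ε N)]
    rfl
  have hsub : posDomain ε N' ⊆
      {x : Fin N' → T3 | (fun i : Fin N => x (Fin.castLE h i)) ∈ posDomain ε N} := by
    intro x hx i j hij
    exact hx _ _ fun hh => hij (Fin.castLE_injective h hh)
  have hL : (volume (posDomain ε N')).toReal ≤
      ∫ x : Fin N' → T3, (posDomain ε N).indicator (1 : (Fin N → T3) → ℝ)
        (fun i : Fin N => x (Fin.castLE h i)) ∂(Measure.pi fun _ => volume) := by
    have hmeas : MeasurableSet {x : Fin N' → T3 | (fun i : Fin N => x (Fin.castLE h i)) ∈ posDomain ε N} :=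
      (measurableSet_posDomain ε N).preimage (measurable_pi_lambda _ fun i => measurable_pi_apply _)
    have e : (fun x : Fin N' → T3 =>
        (posDomain ε N).indicator (1 : (Fin N → T3) → ℝ) (fun i : Fin N => x (Fin.castLE h i))) =
        {x : Fin N' → T3 | (fun i : Fin N => x (Fin.castLE h i)) ∈ posDomain ε N}.indicator 1 := by
      funext x
      rfl
    rw [e, ← hvolN', integral_indicator_one hmeas]
    exact ENNReal.toReal_mono (measure_ne_top _ _) (measure_mono hsub)
  rw [key, hR] at hL
  exact hL

/-- **Particle removal for the free volume**: for `1 ≤ N ≤ N'` and `η ≥ 0`,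
`hsFreeVolume (η N'/N) N' ≤ hsFreeVolume η N` — both have exclusion distance `(η/N)^{1/3}`.
[cite: Ruelle1969, §3.4] -/
theorem hsFreeVolume_scale_le {η : ℝ} {N N' : ℕ} (hN : 1 ≤ N) (h : N ≤ N') :
    hsFreeVolume (η * N' / N) N' ≤ hsFreeVolume η N := by
  rw [EosCesaro.hsFreeVolume_eq_toReal, EosCesaro.hsFreeVolume_eq_toReal]
  have hN0 : (N : ℝ) ≠ 0 := by exact_mod_cast (Nat.one_le_iff_ne_zero.1 hN)
  have hN'0 : (N' : ℝ) ≠ 0 := by exact_mod_cast (Nat.one_le_iff_ne_zero.1 (hN.trans h))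
  have e : η * N' / N / N' = η / N := by field_simp
  rw [e]
  exact volume_posDomain_le h _

/-! ### The rate `a_N(η) = -N⁻¹ log hsFreeVolume η N` -/

/-- The rate is non-negative (`0 ≤ hsFreeVolume ≤ 1`, `log 0 = 0`). [cite: Ruelle1969, §3.4] -/
theorem rate_nonneg (η : ℝ) (N : ℕ) : 0 ≤ -(N : ℝ)⁻¹ * Real.log (hsFreeVolume η N) := by
  have hlog : Real.log (hsFreeVolume η N) ≤ 0 :=
    Real.log_nonpos (hsFreeVolume_nonneg η N) (hsFreeVolume_le_one η N)
  have hinv : -(N : ℝ)⁻¹ ≤ 0 := neg_nonpos.2 (inv_nonneg.2 (Nat.cast_nonneg N))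
  exact mul_nonneg_of_nonpos_of_nonpos hinv hlog

/-- An exponential lower bound on the free volume bounds the rate: `e^{-CN} ≤ hsFreeVolume η N`
gives `a_N(η) ≤ C`. [cite: Ruelle1969, §3.4] -/
theorem rate_le_of_exp_le {η C : ℝ} {N : ℕ} (hN : 0 < N)
    (h : Real.exp (-(C * N)) ≤ hsFreeVolume η N) :
    -(N : ℝ)⁻¹ * Real.log (hsFreeVolume η N) ≤ C := by
  have hpos : 0 < hsFreeVolume η N := (Real.exp_pos _).trans_le h
  have hlog : -(C * N) ≤ Real.log (hsFreeVolume η N) := by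
    rw [← Real.log_exp (-(C * N))]
    exact Real.log_le_log (Real.exp_pos _) h
  have hN' : (0 : ℝ) < N := by exact_mod_cast hN
  have key : -Real.log (hsFreeVolume η N) ≤ C * N := by linarith
  calc -(N : ℝ)⁻¹ * Real.log (hsFreeVolume η N) = (N : ℝ)⁻¹ * (-Real.log (hsFreeVolume η N)) := by
        ring
    _ ≤ (N : ℝ)⁻¹ * (C * N) := mul_le_mul_of_nonneg_left key (inv_nonneg.2 hN'.le)
    _ = C := by field_simp

/-- The rate increases with the density wherever the free volume is positive: for `0 ≤ η ≤ η'`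
with `0 < hsFreeVolume η' N`, `a_N(η) ≤ a_N(η')`. [cite: Ruelle1969, §3.4] -/
theorem rate_le_rate_of_pos {η η' : ℝ} (hη : 0 ≤ η) (h : η ≤ η') {N : ℕ}
    (hpos : 0 < hsFreeVolume η' N) :
    -(N : ℝ)⁻¹ * Real.log (hsFreeVolume η N) ≤ -(N : ℝ)⁻¹ * Real.log (hsFreeVolume η' N) := by
  have hlog : Real.log (hsFreeVolume η' N) ≤ Real.log (hsFreeVolume η N) :=
    Real.log_le_log hpos (hsFreeVolume_anti hη h N)
  have hinv : -(N : ℝ)⁻¹ ≤ 0 := neg_nonpos.2 (inv_nonneg.2 (Nat.cast_nonneg N))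
  exact mul_le_mul_of_nonpos_left hlog hinv

/-- **Particle removal for the rate**: for `1 ≤ N ≤ N'` with `0 < hsFreeVolume (η N'/N) N'`,
`a_N(η) ≤ (N'/N) a_{N'}(η N'/N)`. [cite: Ruelle1969, §3.4] -/
theorem rate_le_scale_rate {η : ℝ} {N N' : ℕ} (hN : 1 ≤ N) (h : N ≤ N')
    (hpos : 0 < hsFreeVolume (η * N' / N) N') :
    -(N : ℝ)⁻¹ * Real.log (hsFreeVolume η N) ≤
      (N' : ℝ) / N * (-(N' : ℝ)⁻¹ * Real.log (hsFreeVolume (η * N' / N) N')) := by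
  have hN0 : (0 : ℝ) < N := by exact_mod_cast hN
  have hN'0 : (0 : ℝ) < N' := by exact_mod_cast (lt_of_lt_of_le hN h)
  have hlog : Real.log (hsFreeVolume (η * N' / N) N') ≤ Real.log (hsFreeVolume η N) :=
    Real.log_le_log hpos (hsFreeVolume_scale_le hN h)
  have e : (N' : ℝ) / N * (-(N' : ℝ)⁻¹ * Real.log (hsFreeVolume (η * N' / N) N')) =
      -(N : ℝ)⁻¹ * Real.log (hsFreeVolume (η * N' / N) N') := by
    field_simp
  rw [e]
  have hinv : -(N : ℝ)⁻¹ ≤ 0 := neg_nonpos.2 (inv_nonneg.2 hN0.le)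
  exact mul_le_mul_of_nonpos_left hlog hinv

/-! ### The `limsup` free energy -/

/-- The excess free energy is non-negative — for every `η`, including the junk value `0` of an
unbounded `limsup` (every eventual upper bound of the non-negative rate is `≥ 0`, and
`sInf ∅ = 0`). [cite: Ruelle1969, §3.4] -/
theorem hsExcessFreeEnergy_nonneg (η : ℝ) : 0 ≤ hsExcessFreeEnergy η := by
  rw [hsExcessFreeEnergy, Filter.limsup_eq]
  refine Real.sInf_nonneg ?_
  intro a ha
  obtain ⟨N, hN⟩ := (Filter.eventually_atTop.1 ha)
  exact (rate_nonneg η N).trans (hN N le_rfl)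

/-- An eventual bound on the rate bounds the free energy: `(∀ᶠ N, a_N(η) ≤ C) → f_ex(η) ≤ C`.
[cite: Ruelle1969, §3.4] -/
theorem hsExcessFreeEnergy_le_of_eventually_le {η C : ℝ}
    (h : ∀ᶠ N : ℕ in atTop, -(N : ℝ)⁻¹ * Real.log (hsFreeVolume η N) ≤ C) :
    hsExcessFreeEnergy η ≤ C :=
  Filter.limsup_le_of_le (Filter.isCoboundedUnder_le_of_le atTop (rate_nonneg η)) h

/-- Under an eventual bound on the rate, the rate is eventually below `f_ex(η) + ε` for every
`ε > 0` (the `limsup` is not a junk value). [cite: Ruelle1969, §3.4] -/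
theorem eventually_rate_le_add {η C : ℝ}
    (h : ∀ᶠ N : ℕ in atTop, -(N : ℝ)⁻¹ * Real.log (hsFreeVolume η N) ≤ C) {ε : ℝ} (hε : 0 < ε) :
    ∀ᶠ N : ℕ in atTop, -(N : ℝ)⁻¹ * Real.log (hsFreeVolume η N) ≤ hsExcessFreeEnergy η + ε := by
  have hlt : hsExcessFreeEnergy η < hsExcessFreeEnergy η + ε := lt_add_of_pos_right _ hε
  have hb : IsBoundedUnder (· ≤ ·) atTop fun N : ℕ => -(N : ℝ)⁻¹ * Real.log (hsFreeVolume η N) :=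
    Filter.isBoundedUnder_of_eventually_le h
  exact (Filter.eventually_lt_of_limsup_lt hlt hb).mono fun N hN => hN.le

/-- **Monotonicity of the free energy in the density**, under eventual positivity and an eventual
rate bound at the larger density: for `0 ≤ η ≤ η'`, `f_ex(η) ≤ f_ex(η')`. [cite: Ruelle1969, §3.4] -/
theorem hsExcessFreeEnergy_mono_of {η η' C : ℝ} (hη : 0 ≤ η) (h : η ≤ η')
    (hpos : ∀ᶠ N : ℕ in atTop, 0 < hsFreeVolume η' N)
    (hb : ∀ᶠ N : ℕ in atTop, -(N : ℝ)⁻¹ * Real.log (hsFreeVolume η' N) ≤ C) :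
    hsExcessFreeEnergy η ≤ hsExcessFreeEnergy η' := by
  unfold hsExcessFreeEnergy
  refine Filter.limsup_le_limsup (hpos.mono fun N hN => rate_le_rate_of_pos hη h hN) ?_ ?_
  · exact Filter.isCoboundedUnder_le_of_le atTop (rate_nonneg η)
  · exact Filter.isBoundedUnder_of_eventually_le hb

end HsFreeEnergyConvex

end Summit.AtomisticToContinuum.HydrodynamicLimit.Theorems
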